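import Summits.QuantumFields.YangMills.Theorems.UnitScaleTiltFluctuationComparisonRegPrGlobalSlackLegCfgDistNaturalT3
import Summits.QuantumFields.YangMills.Theorems.UnitScaleTiltFluctuationComparisonRegPrGlobalSlackCanonicalEndToEnd
import HarnessLib

/-!
# `UnitScaleTiltFluctuationComparisonRegPrGlobalSlackLegCfgDistNaturalT3Gamma` — THE WINDOW LETTERS OF `…LegCfgDistNaturalT3` FROM ONE COUPLING THRESHOLD: the I-11 row
# `CfgDistΦ` for the natural configuration family `B♮` below an EXPLICIT `γ♮ = gammaθ b₀ p₁ σ♮` (crux `FluctuationComparisonRegPrIntL`, stmt-QuantumFields-20520, skeletons v5kC / v5kD,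
# STUB 3⁗χ; cell `pub/ym-inputs`, seat ym-inputs-p11; count-neutral helper, def-free, registry untouched)

WHY.  `cfgDistΦ_chi_natural` (`…LegCfgDistNaturalT3`) carries the four `K`-uniform window letters `hθ` («`θ_{b₀,p₁}(n) ≤ a₁`, `B₃θ ≤ a₀`, `143(7²/4)²·B₃θ ≤ ⅓`, `2B₃θ ≤ 2δ_{SU(2)}/(7L)²`
for every `n < K`»).  The door display `K1aLegRowsDisplayChiAt(Low)` quantifies `∃ γB > 0, ∀ γ ≤ γB`; at a coherent package (`(p K).a₀ = a₀`, `(p K).a₁ = a₁`) all four letters follow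
from ONE bound `θ_{b₀,p₁}(n) ≤ σ♮`, `σ♮ := min a₁ (min (a₀/B₃) (min (1/(3·143·(7²/4)²·B₃)) (δ_{SU(2)}/((7L)²·B₃))))`, which `T3Thresholds.θBal_le_of_le_gamma` delivers at every height from
`γ ≤ gammaθ b₀ p₁ σ♮` (`GlobalSlackCanonicalPolymers.gammaθ`, the cell's standing threshold shape).  So: `windowLetters_of_le_gammaθ` and ★`cfgDistΦ_chi_natural_of_le_gammaθ` — the
I-11 row for `B♮` at every `p₁ ≥ p₀ + r₀` and every `0 < γ ≤ min 1 (gammaθ 𝔠.b₀ p₁ σ♮)` (a positive threshold, `gammaθ_pos`).  Nothing of [Balaban1985UV3] / [Balaban1985Variational] /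
[Balaban1985Averaging] asserted beyond the cited tree theorems; no summit / rung / gap claim (YM₃ on T³ is ladder rung R3, not the Clay problem).

References: T. Bałaban, CMP 102 (1985) 255–275 [Balaban1985UV3] ((7) p.257, (27)–(28) p.263, (43)–(44) pp.266–267); CMP 102 (1985) 277–309 [Balaban1985Variational] (Thm 1 (8)
p.279); CMP 98 (1985) 17–51 [Balaban1985Averaging] (Prop. 2 (54) p.26).
-/

set_option autoImplicit false

noncomputable section

open scoped Matrix.Norms.L2Operator
open Literature.MathematicalPhysics.QuantumFieldTheory.Balaban1983to89
open Literature.MathematicalPhysics.QuantumFieldTheory.Balaban1983to89.T3ContinuumYM3Torus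
open Literature.MathematicalPhysics.QuantumFieldTheory.Balaban1983to89.T3UnitLawDensityEML (ℰp)
open Literature.MathematicalPhysics.QuantumFieldTheory.Balaban1983to89.T3UnitScaleTilt (θBal)
open Literature.MathematicalPhysics.QuantumFieldTheory.Balaban1983to89.T3LevelShift (fieldShift)
open Literature.MathematicalPhysics.QuantumFieldTheory.Balaban1983to89.TreeLengthTorus (tsys)
open Literature.MathematicalPhysics.QuantumFieldTheory.Balaban1983to89.B10Eq27TorusAxialLog
open Literature.MathematicalPhysics.QuantumFieldTheory.Balaban1983to89.B7Prop1Explicit (l1)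
open Literature.MathematicalPhysics.QuantumFieldTheory.Balaban1983to89.ExpMeanLog (deltaSU deltaSU_pos)
open Literature.MathematicalPhysics.QuantumFieldTheory.Balaban1985CMP102
open Literature.MathematicalPhysics.QuantumFieldTheory.Balaban1985CMP102.Setting
open Summit.QuantumFields.Balaban3D.Carriers
open Summit.QuantumFields.Balaban3D.Proofs.Primitives
open Summit.QuantumFields.Balaban3D.Proofs.GroupModelLieC (vecE lieC)
open Summit.QuantumFields.YangMills.Theorems
open Summit.QuantumFields.YangMills.Theorems.GlobalSlackCanonicalPolymers

namespace Summit.QuantumFields.YangMills.Theorems.GlobalSlackKernelLeg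

variable {F : T3Family} {𝔠 : AlphaConsts F.L (suGroupModel 2).N} {γ : ℝ} {hγ : 0 < γ} {hγ1 : γ ≤ (min 𝔠.gamma0 1) ^ 2}

/-- **THE FOUR WINDOW LETTERS FROM ONE COUPLING THRESHOLD**: for `0 < a₀, a₁`, `0 < p₁` and `γ ≤ gammaθ b₀ p₁ σ♮`,
`σ♮ = min a₁ (min (a₀/B₃) (min (1/(3·143·(7²/4)²·B₃)) (δ_{SU(2)}/((7L)²·B₃))))`, every height `n` has `θ_{b₀,p₁}(n) ≤ a₁`, `B₃θ ≤ a₀`, `143(7²/4)²·B₃θ ≤ ⅓` and `2B₃θ ≤ 2δ_{SU(2)}/(7L)²`.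
[cite: Balaban1985UV3, (7) p.257, p.267 L1-3] -/
theorem windowLetters_of_le_gammaθ {a₀ a₁ p₁ : ℝ} (hγ0 : 0 < γ) (hγle : γ ≤ 1) (ha₀ : 0 < a₀) (ha₁ : 0 < a₁) (hp₁ : 0 < p₁)
    (hγw : γ ≤ gammaθ 𝔠.b₀ p₁ (min a₁ (min (a₀ / 𝔠.B₃) (min (1 / (3 * (143 * ((((3 + 4 : ℕ) : ℝ)) ^ 2 / 4) ^ 2) * 𝔠.B₃))
      (deltaSU (Fin 2) / ((((3 + 4) * F.L : ℕ) : ℝ) ^ 2 * 𝔠.B₃)))))) (n : ℕ) :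
    θBal F.L γ 𝔠.b₀ p₁ n ≤ a₁ ∧ 𝔠.B₃ * θBal F.L γ 𝔠.b₀ p₁ n ≤ a₀ ∧
      (143 * ((((3 + 4 : ℕ) : ℝ)) ^ 2 / 4) ^ 2) * (𝔠.B₃ * θBal F.L γ 𝔠.b₀ p₁ n) ≤ 1 / 3 ∧
      2 * (𝔠.B₃ * θBal F.L γ 𝔠.b₀ p₁ n) ≤ 2 * deltaSU (Fin 2) / (((3 + 4) * F.L : ℕ) : ℝ) ^ 2 := by
  have hL : 1 ≤ F.L := F.hL.2.le
  have hB : 0 < 𝔠.B₃ := 𝔠.B₃_pos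
  have hδ : 0 < deltaSU (Fin 2) := deltaSU_pos
  have hC : (0 : ℝ) < 143 * ((((3 + 4 : ℕ) : ℝ)) ^ 2 / 4) ^ 2 := by positivity
  have hL7 : (0 : ℝ) < (((3 + 4) * F.L : ℕ) : ℝ) ^ 2 := by have := F.hL.2; positivity
  set σ := min a₁ (min (a₀ / 𝔠.B₃) (min (1 / (3 * (143 * ((((3 + 4 : ℕ) : ℝ)) ^ 2 / 4) ^ 2) * 𝔠.B₃))
      (deltaSU (Fin 2) / ((((3 + 4) * F.L : ℕ) : ℝ) ^ 2 * 𝔠.B₃)))) with hσ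
  have hσ0 : 0 ≤ σ := by rw [hσ]; positivity
  have hθ := T3Thresholds.θBal_le_of_le_gamma hL 𝔠.b₀_pos hp₁ hσ0 hγ0 hγle hγw n
  set θ := θBal F.L γ 𝔠.b₀ p₁ n with hθdef
  have h1 : θ ≤ a₁ := hθ.trans (min_le_left _ _)
  have h2 : θ ≤ a₀ / 𝔠.B₃ := hθ.trans ((min_le_right _ _).trans (min_le_left _ _))
  have h3 : θ ≤ 1 / (3 * (143 * ((((3 + 4 : ℕ) : ℝ)) ^ 2 / 4) ^ 2) * 𝔠.B₃) :=
    hθ.trans ((min_le_right _ _).trans ((min_le_right _ _).trans (min_le_left _ _)))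
  have h4 : θ ≤ deltaSU (Fin 2) / ((((3 + 4) * F.L : ℕ) : ℝ) ^ 2 * 𝔠.B₃) :=
    hθ.trans ((min_le_right _ _).trans ((min_le_right _ _).trans (min_le_right _ _)))
  refine ⟨h1, ?_, ?_, ?_⟩
  · calc 𝔠.B₃ * θ ≤ 𝔠.B₃ * (a₀ / 𝔠.B₃) := mul_le_mul_of_nonneg_left h2 hB.le
      _ = a₀ := by field_simp
  · calc (143 * ((((3 + 4 : ℕ) : ℝ)) ^ 2 / 4) ^ 2) * (𝔠.B₃ * θ)
        ≤ (143 * ((((3 + 4 : ℕ) : ℝ)) ^ 2 / 4) ^ 2) * (𝔠.B₃ * (1 / (3 * (143 * ((((3 + 4 : ℕ) : ℝ)) ^ 2 / 4) ^ 2) * 𝔠.B₃))) := by gcongr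
      _ = 1 / 3 := by field_simp
  · calc 2 * (𝔠.B₃ * θ) ≤ 2 * (𝔠.B₃ * (deltaSU (Fin 2) / ((((3 + 4) * F.L : ℕ) : ℝ) ^ 2 * 𝔠.B₃))) := by gcongr
      _ = 2 * deltaSU (Fin 2) / (((3 + 4) * F.L : ℕ) : ℝ) ^ 2 := by field_simp

open Classical in
/-- **THE I-11 ROW `CfgDistΦ` FOR THE NATURAL FAMILY `B♮` BELOW AN EXPLICIT COUPLING THRESHOLD**: at a coherent package (`(p K).a₀ = a₀`, `(p K).a₁ = a₁`), for every profile
`p₁ ≥ p₀ + r₀` and every coupling `γ ≤ gammaθ b₀ p₁ σ♮`, `CfgDistΦ (dataOfV3chi p (canonPolymerCore (toCore ∘ p))) B♮ (canonLegDist F) 𝔠.b₀ p₁ (max (24LB₃) (cB·(√L)⁻¹(1+log √L)^{p₁}))`.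
[cite: Balaban1985UV3, (44) p.267, (27)-(28) p.263, (7) p.257; Balaban1985Variational, Thm 1 (8) p.279; Balaban1985Averaging, Prop. 2 (54) p.26] -/
theorem cfgDistΦ_chi_natural_of_le_gammaθ (p : ∀ K, AlphaInputsT3AC.PkgAtV3Chi F 𝔠 γ hγ hγ1 K) {a₀ a₁ p₁ : ℝ} (ha₀ : 0 < a₀) (ha₁ : 0 < a₁)
    (hp : ∀ K, (p K).a₀ = a₀ ∧ (p K).a₁ = a₁) (hp₁ : 𝔠.p₀ + 𝔠.r₀ ≤ p₁)
    (hγw : γ ≤ gammaθ 𝔠.b₀ p₁ (min a₁ (min (a₀ / 𝔠.B₃) (min (1 / (3 * (143 * ((((3 + 4 : ℕ) : ℝ)) ^ 2 / 4) ^ 2) * 𝔠.B₃))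
      (deltaSU (Fin 2) / ((((3 + 4) * F.L : ℕ) : ℝ) ^ 2 * 𝔠.B₃)))))) :
    CfgDistΦ (AlphaInputsT3AC.dataOfV3chi p (canonPolymerCore fun K => (p K).toCore))
      (fun K k b Y W c =>
        if h : b + 1 = k then birthCfgAt (fun K => (p K).toCore) K b Y (h ▸ W) c
        else if (l1 (rel (anchors_nonempty (F := F) K b Y).choose c.src) : ℝ) *
            (2 * (𝔠.B₃ * θBal F.L γ 𝔠.b₀ p₁ (K - k)) * (((F.L : ℝ) ^ (k - b))⁻¹) ^ 2) ≤ 1 / 2 then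
          (lieC (suGroupModel 2)).orthogonalProjectionOnto
            (vecE (suGroupModel 2).N
              (B27T (unitsField (toUField (Averaging.iter (fun i => BlockAveraging.blockAvg (P := F.P K) (j := i) ℰp) b
                ((p K).UkH k (Hist.triv (F.P K) k) W)))) (anchors_nonempty (F := F) K b Y).choose c))
        else 0)
      (canonLegDist F) 𝔠.b₀ p₁ (max (24 * F.L * 𝔠.B₃) (𝔠.cB * ((Real.sqrt F.L)⁻¹ * (1 + Real.log (Real.sqrt F.L)) ^ p₁))) := by
  have hp₁' : 0 < p₁ := by have := 𝔠.p₀_pos; have := 𝔠.one_le_r₀; linarith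
  refine cfgDistΦ_chi_natural p hp₁ fun K n _ => ?_
  obtain ⟨h1, h2, h3, h4⟩ := windowLetters_of_le_gammaθ (𝔠 := 𝔠) hγ (hγ1.trans (sq_min_one_le _ 𝔠.gamma0_pos)) ha₀ ha₁ hp₁' hγw n
  rw [(hp K).1, (hp K).2]
  exact ⟨h1, h2, h3, h4⟩

end Summit.QuantumFields.YangMills.Theorems.GlobalSlackKernelLeg

end
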